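import Summits.QuantumFields.QCD.Theses.HeatSlicedQuarks

/-!
# Sketch (crux-ideate g2 k1, crux stmt-QuantumFields-8892 `RobustYangMillsHandover`)

Typed first lemmas for the idea card `band-limited-payload`
(Cruxes/RobustYangMillsHandover/Ideas/band-limited-payload.md). Nothing here is proved; every
declaration is a `Prop` that must ELABORATE (crux-ideate rule: no skeleton at this stage).

* `SliceKernelBandLimit`      — a fixed-time heat-slice kernel `E_t = e^{-tH} Dᴴ`, `H = Dᴴ D`, has
                                operator norm `≤ (2 e t)^{-1/2}` for EVERY matrix `D` (hence for the
                                Wilson–Dirac operator of every gauge field): proper slices are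
                                band-limited from above, background-free.
* `SliceKernelLowModes`       — on an `H`-eigenvector of eigenvalue `μ`, `‖D e^{-tH} v‖² = μ e^{-2tμ}‖v‖²`:
                                near-zero singular modes contribute `O(√μ)` to a PROPER slice (they
                                bite only the terminal slice `t ≥ T`).
* `RankNormDetBound`          — `|det(1 + K)| ≤ (1 + κ)^r` for `rank K ≤ r`, `‖K‖ ≤ κ`: the fermionic
                                large-field factor `det(1 + C_j Δ_j)` is paid per MODE at the slice's
                                scale, not per fine site.
* `WilsonSliceBandLimit`      — the instance of the first lemma for the tree's `wilsonDirac` on the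
                                4-torus with `SU(3)` links, any bare mass, any `t > 0`.
* `DislocationCountDiverges`  — along an asymptotically free coupling sequence the expected number of
                                cutoff plaquettes with deficit `≥ θ` inside a FIXED physical block
                                diverges whenever the single-plaquette tail is `≥ c e^{-K β θ}` with
                                `4 b₀ K θ < 4`: large fields at the cutoff are dense in physical volume,
                                so a large-field-robustness clause must be stated history-wise
                                (absolute weights with slack), never as a sup over a collapsed
                                small-field domain (pure real analysis; the tail lower bound itself is
                                informal here).
-/

namespace Summit.QuantumFields.QCD.Cruxes.RobustYangMillsHandover.IdeaSketchG2K1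

open scoped BigOperators Matrix
open Filter

/-- **Band limit of a proper heat slice (abstract, background-free).** For every square complex
matrix `D`, `H := Dᴴ D` and every `t > 0`, the fixed-time slice kernel `E_t := exp(-t H) Dᴴ` obeys
`‖E_t v‖² ≤ (2 e t)⁻¹ ‖v‖²` for all `v` — because `E_t E_tᴴ = H e^{-2tH}` and
`max_{σ ≥ 0} σ² e^{-2tσ²} = (2et)⁻¹`. No norm bound on `D` and no property of the background enter. -/
def SliceKernelBandLimit : Prop :=
  ∀ (n : ℕ) (D : Matrix (Fin n) (Fin n) ℂ) (t : ℝ), 0 < t →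
    ∀ v : Fin n → ℂ,
      (∑ i, ‖((NormedSpace.exp (-(t : ℂ) • (Dᴴ * D)) * Dᴴ).mulVec v) i‖ ^ 2)
        ≤ (1 / (2 * Real.exp 1 * t)) * ∑ i, ‖v i‖ ^ 2

/-- **Low modes are invisible to proper slices.** If `(Dᴴ D) v = μ v` then
`‖(D exp(-t Dᴴ D)) v‖² = μ e^{-2tμ} ‖v‖²`: a singular mode of size `σ = √μ` enters the slice
`[t, L² t]` with weight `≤ σ`, so Landau-type / exceptional near-zero modes do not enhance any proper
slice; they bite only the terminal covariance `e^{-TH} D⁻¹`. -/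
def SliceKernelLowModes : Prop :=
  ∀ (n : ℕ) (D : Matrix (Fin n) (Fin n) ℂ) (t μ : ℝ), 0 ≤ t →
    ∀ v : Fin n → ℂ, (Dᴴ * D).mulVec v = (μ : ℂ) • v →
      (∑ i, ‖((D * NormedSpace.exp (-(t : ℂ) • (Dᴴ * D))).mulVec v) i‖ ^ 2)
        = μ * Real.exp (-(2 * t * μ)) * ∑ i, ‖v i‖ ^ 2

/-- **Pay per mode, not per site.** A finite-rank, norm-bounded perturbation of the identity has
`|det(1 + K)| ≤ (1 + κ)^r` (`rank K ≤ r`, `‖K v‖ ≤ κ‖v‖`): the eigenvalues of `K` are at most `r`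
non-zero numbers of modulus `≤ κ`. Applied to `K = C_j Δ_j` on a scale-`j` large-field region this
charges the fermionic factor `O(1)` per singular MODE of `D` at scale `L^{-j}` localised in the
region — `O(1)` per `j`-block by local Weyl counting plus the action budget (route crux 3) — instead of
`O(1)` per fine site. -/
def RankNormDetBound : Prop :=
  ∀ (n : ℕ) (K : Matrix (Fin n) (Fin n) ℂ) (r : ℕ) (κ : ℝ), 0 ≤ κ → K.rank ≤ r →
    (∀ v : Fin n → ℂ, (∑ i, ‖(K.mulVec v) i‖ ^ 2) ≤ κ ^ 2 * ∑ i, ‖v i‖ ^ 2) →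
      ‖(1 + K).det‖ ≤ (1 + κ) ^ r

/-- **The Wilson–Dirac instance** of `SliceKernelBandLimit`: for every torus side `L`, every `SU(3)`
gauge field `U`, every bare mass `m` (no sign restriction — the scheme's bare masses are eventually
NEGATIVE, Disproof §9(ii)) and every `t > 0`, the slice kernel of
`D = wilsonDirac (fundamentalRep (Fin 3)) U m 1` is band-limited by `(2et)^{-1/2}` uniformly in
`(L, U, m)`. This is what makes the large-field payload background-free on THIS route (heat slicing),
in contrast with block-spin fermion covariances that invert background-dependent block operators
(negatives index: stmt-QuantumFields-9494). -/
def WilsonSliceBandLimit : Prop :=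
  ∀ (L : ℕ) [NeZero L]
    (U : Literature.MathematicalPhysics.QuantumFieldTheory.GaugeConfig 4 L
      (Matrix.specialUnitaryGroup (Fin 3) ℂ)) (m t : ℝ), 0 < t →
    ∀ v : Literature.Probability.LatticeModels.TorusSite 4 L × Fin 3 × Fin 4 → ℂ,
      (∑ i, ‖((NormedSpace.exp (-(t : ℂ) •
          (Matrix.conjTranspose
              (Literature.MathematicalPhysics.QuantumLattice.wilsonDirac
                (Literature.MathematicalPhysics.QuantumLattice.fundamentalRep (Fin 3)) U m 1) *
            Literature.MathematicalPhysics.QuantumLattice.wilsonDirac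
              (Literature.MathematicalPhysics.QuantumLattice.fundamentalRep (Fin 3)) U m 1)) *
          Matrix.conjTranspose
            (Literature.MathematicalPhysics.QuantumLattice.wilsonDirac
              (Literature.MathematicalPhysics.QuantumLattice.fundamentalRep (Fin 3)) U m 1)).mulVec v) i‖ ^ 2)
        ≤ (1 / (2 * Real.exp 1 * t)) * ∑ i, ‖v i‖ ^ 2

/-- **Cutoff large fields are dense in physical volume along asymptotically free sequences** (the
real-analysis half; the single-plaquette tail lower bound `P_β(3 − Re tr U_p ≥ θ) ≥ c e^{-K β θ}`,
`K = 7` from re-setting one link, is the informal input). If `β_k − afBeta N_f Λ a_k → 0` then for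
every physical block size `ℓ₀ > 0`, every `θ > 0` and every `K > 0` with `4 b₀(N_f) K θ < 4`, the
count `(ℓ₀ / a_k)^4 · e^{-K β_k θ}` tends to `+∞`: since `β_k ≈ 4 b₀ log(1/(a_k Λ))`, the factor
`e^{-K β_k θ} = (a_k Λ)^{4 b₀ K θ + o(1)}` loses against `a_k^{-4}`. For `N_f = 0`, `K = 7`: all
`θ < 16π²/77 ≈ 2.05` (max deficit `4.5`). -/
def DislocationCountDiverges : Prop :=
  ∀ (Nf : ℕ) (a β : ℕ → ℝ) (Λ ℓ₀ θ K : ℝ), (∀ k, 0 < a k) → Tendsto a atTop (nhds 0) →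
    0 < Λ → Tendsto (fun k => β k - Literature.MathematicalPhysics.QuantumFieldTheory.afBeta Nf Λ (a k))
      atTop (nhds 0) →
    0 < ℓ₀ → 0 < θ → 0 < K →
    4 * Literature.MathematicalPhysics.QuantumFieldTheory.betaCoeff₀ Nf * K * θ < 4 →
      Tendsto (fun k => (ℓ₀ / a k) ^ 4 * Real.exp (-(K * β k * θ))) atTop atTop

end Summit.QuantumFields.QCD.Cruxes.RobustYangMillsHandover.IdeaSketchG2K1
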